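import Literature.Computability.QuantumComplexity.ZXCalculusSpiders
import HarnessLib

/-!
# `ZX_{π/4}` modulo the calculus: the Figure-1 rules as equalities; bending spider legs

Topic `Literature/Computability/QuantumComplexity`, continuing `ZXCalculusSpiders.lean` (layer A7 of
the formalisation of `JeandelPerdrixVilmart2018_completeness`).

1. The remaining rules of JPV's Figure 1 as equalities of classes, split into classes of
   generators (`rule_E`, `rule_B1`, `rule_B2`, `rule_K`, `rule_SUP`, `rule_EU`, `rule_H`, `rule_C`,
   `rule_BW`), ready for `rw`.
2. Bending legs of spiders with the cup `η = Z^{(0,2)}(0)` and the cap `ε = Z^{(2,0)}(0)` ((S3) and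
   (S1)): an input of a green spider bent into an output (`cup_bend_Z`) and conversely
   (`Z_bend_cap`), states versus effects (`cup_seq_par_effect`, `state_par_seq_cap`), phases
   slide around cups and caps (`cup_seq_phase_left`, …), and the same for red spiders (the cup and
   the cap are colourless: `X_zero_two`).

## References

* E. Jeandel, S. Perdrix, R. Vilmart, LICS 2018 (arXiv:1705.11151v2), Fig. 1 and §2.2 ("only
  topology matters") [JeandelPerdrixVilmart2018].
* B. Coecke, R. Duncan, New J. Phys. 13 (2011), §6 [CoeckeDuncan2011].
-/

noncomputable section

namespace Literature.Computability.QuantumComplexity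

open ZXDiagram ZXClass

variable {n m j k n' m' : ℕ}

namespace ZXClass

/-! ### The rules of Figure 1 as equalities of classes -/

/-- **(E)**: the scalar `Z^{(0,1)}(π/4) ⨾ X^{(1,0)}(-π/4)` is the empty diagram. [cite: JeandelPerdrixVilmart2018, Fig. 1 (E)] -/
theorem rule_E : mk (Z 0 1 1) ⨟ mk (X 1 0 (-1)) = mk (wires 0) := by
  simpa using Rule.e_rule.eq

/-- **(B1)** (copy), with JPV's scalar `√2 = X^{(0,1)}(0) ⨾ Z^{(1,0)}(0)` on the left.
[cite: JeandelPerdrixVilmart2018, Fig. 1 (B1)] -/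
theorem rule_B1 : mk (dumbbell 0 0) ⊠ (mk (X 0 1 0) ⨟ mk (Z 1 2 0)) = mk (X 0 1 0) ⊠ mk (X 0 1 0) := by
  simpa using Rule.copy.eq

/-- **(B2)** (bialgebra), with JPV's scalar `√2` on the left. [cite: JeandelPerdrixVilmart2018, Fig. 1 (B2)] -/
theorem rule_B2 : mk (dumbbell 0 0) ⊠ ((mk (Z 1 2 0) ⊠ mk (Z 1 2 0)) ⨟
    ((mk (wires 1) ⊠ mk swap) ⊠ mk (wires 1)) ⨟ (mk (X 2 1 0) ⊠ mk (X 2 1 0))) =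
      mk (X 2 1 0) ⨟ mk (Z 1 2 0) := by
  simpa using Rule.bialgebra.eq

/-- **(K)** (π-commutation), with its scalars. [cite: JeandelPerdrixVilmart2018, Fig. 1 (K)] -/
theorem rule_K (a : ZMod 8) : mk (dumbbell 0 0) ⊠ (mk (X 1 1 a) ⨟ mk (Z 1 1 4)) =
    mk (dumbbell a 4) ⊠ (mk (Z 1 1 4) ⨟ mk (X 1 1 (-a))) := by
  simpa using (Rule.pi_comm a).eq

/-- **(SUP)** (supplementarity). [cite: JeandelPerdrixVilmart2018, Fig. 1 (SUP)] -/
theorem rule_SUP (a : ZMod 8) :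
    (mk (Z 0 1 a) ⊠ mk (Z 0 1 (a + 4))) ⨟ mk (X 2 1 0) = mk (Z 0 2 (2 * a + 4)) ⨟ mk (X 2 1 0) := by
  simpa using (Rule.supp a).eq

/-- **(EU)** (Euler decomposition of the Hadamard box). [cite: JeandelPerdrixVilmart2018, Fig. 1 (EU)] -/
theorem rule_EU : mk hBox = (mk (Z 1 1 2) ⊠ mk (Z 0 1 (-2))) ⨟ mk (X 2 1 0) ⨟ mk (Z 1 1 2) := by
  simpa using Rule.euler.eq

/-- **(H)** (colour change) at all arities: `H^{⊗n} ⨾ X^{(n,m)}(a) ⨾ H^{⊗m} = Z^{(n,m)}(a)`. [cite: JeandelPerdrixVilmart2018, Fig. 1 (H)] -/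
theorem rule_H (n m : ℕ) (a : ZMod 8) :
    mk (hTensor n) ⨟ mk (X n m a) ⨟ mk (hTensor m) = mk (Z n m a) := by
  simpa using (Rule.color n m a).eq

/-- (H) with the colours exchanged: `H^{⊗n} ⨾ Z^{(n,m)}(a) ⨾ H^{⊗m} = X^{(n,m)}(a)`. [cite: JeandelPerdrixVilmart2018, Fig. 1 (H)] -/
theorem rule_H' (n m : ℕ) (a : ZMod 8) :
    mk (hTensor n) ⨟ mk (Z n m a) ⨟ mk (hTensor m) = mk (X n m a) := by
  have h := congrArg colorSwap (rule_H n m a)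
  simp only [colorSwap_seq, colorSwap_mk, colorSwap_X, colorSwap_Z] at h
  have hH : ∀ p, (hTensor p).colorSwap = hTensor p := by
    intro p
    induction p with
    | zero => rfl
    | succ p ih => simp only [hTensor, ZXDiagram.colorSwap_par, ih, ZXDiagram.colorSwap_hBox]
  simpa only [hH] using h

/-- **(C)** (commutation of controls). [cite: JeandelPerdrixVilmart2018, Fig. 1 (C)] -/
theorem rule_C (a b g : ZMod 8) : mk (cLhs a b g) = mk (cRhs a b g) := (Rule.ctrl_comm a b g).eq

/-- **(BW)**. [cite: JeandelPerdrixVilmart2018, Fig. 1 (BW)] -/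
theorem rule_BW : mk bwLhs = mk bwRhs := Rule.bw.eq

/-! ### Bending legs of green spiders -/

/-- The cup as the spider `Z^{(0,1+1)}(0)` (the arity written as a sum, the form fusion produces).
[cite: JeandelPerdrixVilmart2018, Fig. 1 (S3)] -/
theorem Z_zero_one_add_one : mk (Z 0 (1 + 1) 0) = mk cup := Z_zero_two

/-- The cap as the spider `Z^{(1+1,0)}(0)`. [cite: JeandelPerdrixVilmart2018, Fig. 1 (S3)] -/
theorem Z_one_add_one_zero : mk (Z (1 + 1) 0 0) = mk cap := Z_two_zero

/-- **Bending an input into an output**: feeding the second end of a cup into the first input of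
`Z^{(1+n,m)}(a)` gives `Z^{(n,1+m)}(a)` (arities written `0 + n`, `1 + m` as fusion produces them;
spiders absorb the identity casts that convert them). [cite: JeandelPerdrixVilmart2018, §2.2] -/
theorem cup_bend_Z (n m : ℕ) (a : ZMod 8) :
    (mk cup ⊠ mk (wires n)) ⨟ ofEq (Nat.add_assoc 1 1 n) ⨟ (mk (wires 1) ⊠ mk (Z (1 + n) m a)) =
      mk (Z (0 + n) (1 + m) a) := by
  rw [← Z_zero_one_add_one]
  simpa using fusion 0 1 1 m n le_rfl 0 a

/-- **Bending an output into an input**: closing the first output of `Z^{(m,1+n)}(a)` with a cap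
against a fresh input gives `Z^{(1+m,n)}(a)`. [cite: JeandelPerdrixVilmart2018, §2.2] -/
theorem Z_bend_cap (m n : ℕ) (a : ZMod 8) :
    (mk (wires 1) ⊠ mk (Z m (1 + n) a)) ⨟ ofEq (Nat.add_assoc 1 1 n).symm ⨟ (mk cap ⊠ mk (wires n)) =
      mk (Z (1 + m) (0 + n) a) := by
  have h := congrArg transpose (cup_bend_Z n m a)
  simpa [seq_assoc] using h

/-- A cup followed by a green effect on its second end is a green state:
`η ⨾ (𝕀 ⊗ Z^{(1,0)}(a)) = Z^{(0,1)}(a)`. [cite: JeandelPerdrixVilmart2018, §2.2] -/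
theorem cup_seq_par_effect (a : ZMod 8) :
    mk cup ⨟ (mk (wires 1) ⊠ mk (Z 1 0 a)) = mk (Z 0 1 a) := by
  rw [← Z_zero_one_add_one, Z_seq_par_Z 0 1 1 0 le_rfl, zero_add]

/-- A cup followed by a green effect on its first end is a green state. [cite: JeandelPerdrixVilmart2018, §2.2] -/
theorem cup_seq_effect_par (a : ZMod 8) :
    mk cup ⨟ (mk (Z 1 0 a) ⊠ mk (wires 1)) = mk (Z 0 1 a) := by
  rw [← Z_zero_one_add_one, Z_seq_Z_par 0 1 1 0 le_rfl, add_zero]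

/-- A green state on the second end of a cap is a green effect:
`(𝕀 ⊗ Z^{(0,1)}(a)) ⨾ ε = Z^{(1,0)}(a)`. [cite: JeandelPerdrixVilmart2018, §2.2] -/
theorem par_state_seq_cap (a : ZMod 8) :
    (mk (wires 1) ⊠ mk (Z 0 1 a)) ⨟ mk cap = mk (Z 1 0 a) := by
  have h := congrArg transpose (cup_seq_par_effect a)
  simpa using h

/-- A green state on the first end of a cap is a green effect. [cite: JeandelPerdrixVilmart2018, §2.2] -/
theorem state_par_seq_cap (a : ZMod 8) :
    (mk (Z 0 1 a) ⊠ mk (wires 1)) ⨟ mk cap = mk (Z 1 0 a) := by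
  have h := congrArg transpose (cup_seq_effect_par a)
  simpa using h

/-- A phase slides around a cup: on the second end … [cite: JeandelPerdrixVilmart2018, §2.2] -/
theorem cup_seq_par_phase (a : ZMod 8) :
    mk cup ⨟ (mk (wires 1) ⊠ mk (Z 1 1 a)) = mk (Z 0 2 a) := by
  rw [← Z_zero_one_add_one, Z_seq_par_Z 0 1 1 1 le_rfl, zero_add]

/-- … equals on the first end; both are `Z^{(0,2)}(a)`. [cite: JeandelPerdrixVilmart2018, §2.2] -/
theorem cup_seq_phase_par (a : ZMod 8) :
    mk cup ⨟ (mk (Z 1 1 a) ⊠ mk (wires 1)) = mk (Z 0 2 a) := by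
  rw [← Z_zero_one_add_one, Z_seq_Z_par 0 1 1 1 le_rfl, add_zero]

/-- A phase slides around a cap: on the second end … [cite: JeandelPerdrixVilmart2018, §2.2] -/
theorem par_phase_seq_cap (a : ZMod 8) :
    (mk (wires 1) ⊠ mk (Z 1 1 a)) ⨟ mk cap = mk (Z 2 0 a) := by
  have h := congrArg transpose (cup_seq_par_phase a)
  simpa using h

/-- … equals on the first end; both are `Z^{(2,0)}(a)`. [cite: JeandelPerdrixVilmart2018, §2.2] -/
theorem phase_par_seq_cap (a : ZMod 8) :
    (mk (Z 1 1 a) ⊠ mk (wires 1)) ⨟ mk cap = mk (Z 2 0 a) := by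
  have h := congrArg transpose (cup_seq_phase_par a)
  simpa using h

/-! ### The same in red -/

/-- A cup followed by a red effect on its second end is a red state. [cite: JeandelPerdrixVilmart2018, §2.2] -/
theorem cup_seq_par_xeffect (a : ZMod 8) :
    mk cup ⨟ (mk (wires 1) ⊠ mk (X 1 0 a)) = mk (X 0 1 a) := by
  have h := congrArg colorSwap (cup_seq_par_effect a)
  simpa using h

/-- A cup followed by a red effect on its first end is a red state. [cite: JeandelPerdrixVilmart2018, §2.2] -/
theorem cup_seq_xeffect_par (a : ZMod 8) :
    mk cup ⨟ (mk (X 1 0 a) ⊠ mk (wires 1)) = mk (X 0 1 a) := by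
  have h := congrArg colorSwap (cup_seq_effect_par a)
  simpa using h

/-- A red state on the second end of a cap is a red effect. [cite: JeandelPerdrixVilmart2018, §2.2] -/
theorem par_xstate_seq_cap (a : ZMod 8) :
    (mk (wires 1) ⊠ mk (X 0 1 a)) ⨟ mk cap = mk (X 1 0 a) := by
  have h := congrArg colorSwap (par_state_seq_cap a)
  simpa using h

/-- A red state on the first end of a cap is a red effect. [cite: JeandelPerdrixVilmart2018, §2.2] -/
theorem xstate_par_seq_cap (a : ZMod 8) :
    (mk (X 0 1 a) ⊠ mk (wires 1)) ⨟ mk cap = mk (X 1 0 a) := by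
  have h := congrArg colorSwap (state_par_seq_cap a)
  simpa using h

/-- A red phase slides around a cup. [cite: JeandelPerdrixVilmart2018, §2.2] -/
theorem cup_seq_par_xphase (a : ZMod 8) :
    mk cup ⨟ (mk (wires 1) ⊠ mk (X 1 1 a)) = mk cup ⨟ (mk (X 1 1 a) ⊠ mk (wires 1)) := by
  have h := congrArg colorSwap ((cup_seq_par_phase a).trans (cup_seq_phase_par a).symm)
  simpa using h

/-- A red phase slides around a cap. [cite: JeandelPerdrixVilmart2018, §2.2] -/
theorem par_xphase_seq_cap (a : ZMod 8) :
    (mk (wires 1) ⊠ mk (X 1 1 a)) ⨟ mk cap = (mk (X 1 1 a) ⊠ mk (wires 1)) ⨟ mk cap := by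
  have h := congrArg colorSwap ((par_phase_seq_cap a).trans (phase_par_seq_cap a).symm)
  simpa using h

end ZXClass

end Literature.Computability.QuantumComplexity
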